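import Literature.RepresentationTheory.ClassicalInvariants.VectorCovectorFFT
import Literature.Analysis.SegalBargmann.FockOneParameter
import Literature.Analysis.SegalBargmann.FockSubstitutionEigenvectors
import HarnessLib

/-!
# First fundamental theorem for `U(n)` on `V ⊕ V̄`, group form: the `U(n)`-invariant polynomials are `ℂ[P]`

Topic `Literature/RepresentationTheory/ClassicalInvariants`; continuation of `VectorCovectorFFT` (the INFINITESIMAL
form: `E_{ab} f = 0` for all polarisation operators `E_{ab} = z_a ∂_{z_b} − w_b ∂_{w_a}` iff `f ∈ ℂ[P]`,
`P = Σ_a z_a w_a`).  Here the compact group `U(n)` acts on `ℂ[z_1..z_n, w_1..w_n]` by the linear substitution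
`z ↦ ḡ z`, `w ↦ g w` (`vcBlock g = diag(ḡ, g)`; the tree's `linSubst`, `(F ∘ M)(x) = F(Mx)`): the standard
representation on the `w`'s and its complex conjugate = contragredient (`ḡ = (gᵀ)⁻¹` for unitary `g`) on the `z`'s —
the shape in which the maximal compact `U(V)` of a DEFINITE hermitian space `V` acts on the Fock polynomials of
`V ⊗ W` for a plane `W` of signature `(1,1)` (one column conjugated, one not: Folland 1989 Prop. (4.39) with the compact
dual pair block datum, tree `FockDualPairCompact.dualPairι`; Howe 1989 §§3–4).

**Theorem** (`isVCUnitaryInvariant_iff`, `n ≥ 1`).  `F ∈ ℂ[z, w]` satisfies `F(ḡz, gw) = F(z, w)` for all `g ∈ U(n)` iff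
`F ∈ span_ℂ {P^k : k ∈ ℕ}`; a HOMOGENEOUS invariant of degree `d` is `c · P^{d/2}` (`d` even) or `0` (`d` odd)
(`IsVCUnitaryInvariant.eq_smul_pairing_pow_of_isHomogeneous`).

This is Goodman–Wallach, *Symmetry, Representations, and Invariants* (GTM 255) Thm 5.2.1 (polynomial FFT for `GL(V)`,
case `k = m = 1`) for the compact form: "`𝒫((V^*)^k ⊕ V^m)^{GL(V)}` is generated by the contractions `⟨v_i^*, v_j⟩`",
together with the Weyl unitarian trick `U(n)`-invariant ⇔ `𝔤𝔩_n(ℂ)`-invariant for polynomial representations; Howe,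
*Remarks on classical invariant theory*, Trans. AMS 313 (1989) Thm 1A/Thm 2.  Proof here (no cited fact used as a
hypothesis): (i) differentiate the invariance along the one-parameter subgroups `e^{tX}`, `X ∈ 𝔲(n)` (tree
`FockOneParameter.expUnitary`, `FockInfinitesimalAction.hasDerivAt_coeff_linSubst`): the velocity of `vcBlock (e^{tX})`
is `diag(X̄, X) = diag(−Xᵀ, X)`, and `dΓ(diag(−Yᵀ, Y)) = Σ_{ab} Y_{ab} E_{ab}` (`dGamma_vcGen`); (ii) complexify:
`Y ↦ Σ Y_{ab} E_{ab} F` is `ℂ`-linear and vanishes on `𝔲(n)`, hence on `𝔤𝔩_n(ℂ) = 𝔲(n) ⊕ i𝔲(n)` — in particular every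
`E_{ab} F = 0` (`polarization_eq_zero_of_isVCUnitaryInvariant`); (iii) `VectorCovectorFFT.isGLnInvariant_iff`.
Conversely `P` is invariant (`ḡᵀ g = (gᴴ g)‾ = 1`, tree `linSubst_pairingPoly_of_unitary`).

Use (pub-hodgecm model cell, rows A12/A34): at a real place of type `Σ₁₂` (definite `V_b ≅ ℂ³`, `W_b` of signature
`(1,1)`) the `K_{V,b} = U(3)`-invariant Fock polynomials are `ℂ[P]` — PerL v5 Lemma 4.1(b) "invariants `ℂ[P]`" at
GROUP level, the algebraic half of the census field `dense` at such a place (the analytic half is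
`SegalBargmann/SchwartzHermiteDegreeComponents`).

## References

* [GoodmanWallachGTM255] R. Goodman, N. R. Wallach, *Symmetry, Representations, and Invariants*, GTM 255, Springer
  2009, Thm 5.2.1, §5.4.2. [cite: GoodmanWallachGTM255, Thm 5.2.1]
* [Howe1989Remarks] R. Howe, Remarks on classical invariant theory, Trans. AMS 313 (1989) 539–570, Thms 1A, 2.
* [Folland1989] G. B. Folland, *Harmonic Analysis in Phase Space*, Princeton UP 1989, Prop. (4.39), Ch. 4 §5.

Provenance: LEAN-IN-TREE rule (2026-08-18), pub-hodgecm model-construction sub-cell, seat mc-binder-2 gen 5; KERNEL only.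
-/

noncomputable section

open MvPolynomial Matrix Complex
open scoped BigOperators ComplexConjugate

namespace Literature.RepresentationTheory.ClassicalInvariants

open Literature.Analysis.SegalBargmann

variable {n : ℕ}

/-! ### The substitution `z ↦ ḡ z`, `w ↦ g w` -/

/-- **The vector–covector block matrix of `g`**: `diag(ḡ, g)` on the variables `z = inl`, `w = inr` (entrywise
conjugate on the `z`-block). [folklore] -/
def vcBlock (g : Matrix (Fin n) (Fin n) ℂ) : Matrix (VCVar n) (VCVar n) ℂ :=
  Matrix.fromBlocks (g.map (starRingEnd ℂ)) 0 0 g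

/-- The `(z,z)`-block entry. [folklore] -/
@[simp] theorem vcBlock_inl_inl (g : Matrix (Fin n) (Fin n) ℂ) (a b : Fin n) :
    vcBlock g (Sum.inl a) (Sum.inl b) = conj (g a b) := rfl

/-- The `(z,w)`-block entry. [folklore] -/
@[simp] theorem vcBlock_inl_inr (g : Matrix (Fin n) (Fin n) ℂ) (a b : Fin n) :
    vcBlock g (Sum.inl a) (Sum.inr b) = 0 := rfl

/-- The `(w,z)`-block entry. [folklore] -/
@[simp] theorem vcBlock_inr_inl (g : Matrix (Fin n) (Fin n) ℂ) (a b : Fin n) :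
    vcBlock g (Sum.inr a) (Sum.inl b) = 0 := rfl

/-- The `(w,w)`-block entry. [folklore] -/
@[simp] theorem vcBlock_inr_inr (g : Matrix (Fin n) (Fin n) ℂ) (a b : Fin n) :
    vcBlock g (Sum.inr a) (Sum.inr b) = g a b := rfl

/-- `vcBlock 1 = 1`. [folklore] -/
theorem vcBlock_one : vcBlock (1 : Matrix (Fin n) (Fin n) ℂ) = 1 := by
  rw [vcBlock, Matrix.map_one _ (map_zero _) (map_one _), Matrix.fromBlocks_one]

/-- The substitution on a `z`-variable: `z_a ↦ Σ_b conj(g_{ab}) z_b`. [folklore] -/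
theorem linSubst_vcBlock_X_inl (g : Matrix (Fin n) (Fin n) ℂ) (a : Fin n) :
    linSubst (vcBlock g) (X (Sum.inl a) : MvPolynomial (VCVar n) ℂ) = ∑ b, C (conj (g a b)) * X (Sum.inl b) := by
  rw [linSubst_X, Fintype.sum_sum_type]
  simp only [vcBlock_inl_inl, vcBlock_inl_inr, C_0, zero_mul, Finset.sum_const_zero, add_zero]

/-- The substitution on a `w`-variable: `w_a ↦ Σ_b g_{ab} w_b`. [folklore] -/
theorem linSubst_vcBlock_X_inr (g : Matrix (Fin n) (Fin n) ℂ) (a : Fin n) :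
    linSubst (vcBlock g) (X (Sum.inr a) : MvPolynomial (VCVar n) ℂ) = ∑ b, C (g a b) * X (Sum.inr b) := by
  rw [linSubst_X, Fintype.sum_sum_type]
  simp only [vcBlock_inr_inl, vcBlock_inr_inr, C_0, zero_mul, Finset.sum_const_zero, zero_add]

/-- **`U(n)`-invariance** of `F ∈ ℂ[z, w]` under `z ↦ ḡz`, `w ↦ gw`. [folklore] -/
def IsVCUnitaryInvariant (F : MvPolynomial (VCVar n) ℂ) : Prop :=
  ∀ g : Matrix.unitaryGroup (Fin n) ℂ, linSubst (vcBlock (g : Matrix (Fin n) (Fin n) ℂ)) F = F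

/-- The invariants form a submodule. [folklore] -/
def vcUnitaryInvariants (n : ℕ) : Submodule ℂ (MvPolynomial (VCVar n) ℂ) where
  carrier := {F | IsVCUnitaryInvariant F}
  zero_mem' g := map_zero _
  add_mem' hF hG g := by rw [map_add, hF g, hG g]
  smul_mem' c F hF g := by rw [map_smul, hF g]

/-- Membership. [folklore] -/
theorem mem_vcUnitaryInvariants_iff (F : MvPolynomial (VCVar n) ℂ) :
    F ∈ vcUnitaryInvariants n ↔ IsVCUnitaryInvariant F := Iff.rfl

/-! ### `P` and its powers are invariant -/

/-- The tree's two pairings agree: `pairing ℂ n = pairingPoly inl inr`. [folklore] -/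
theorem pairing_eq_pairingPoly : pairing ℂ n = pairingPoly (τ := VCVar n) Sum.inl Sum.inr := rfl

/-- The entrywise conjugate of a unitary matrix is unitary. [folklore] -/
theorem map_conj_mem_unitaryGroup (g : Matrix.unitaryGroup (Fin n) ℂ) :
    (g : Matrix (Fin n) (Fin n) ℂ).map (starRingEnd ℂ) ∈ Matrix.unitaryGroup (Fin n) ℂ := by
  rw [Matrix.mem_unitaryGroup_iff]
  have h : (g : Matrix (Fin n) (Fin n) ℂ) * star (g : Matrix (Fin n) (Fin n) ℂ) = 1 :=
    Matrix.mem_unitaryGroup_iff.mp g.2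
  have hstar : star ((g : Matrix (Fin n) (Fin n) ℂ).map (starRingEnd ℂ)) =
      (star (g : Matrix (Fin n) (Fin n) ℂ)).map (starRingEnd ℂ) := by
    ext i j
    simp [Matrix.star_apply, Matrix.map_apply]
  rw [hstar, ← Matrix.map_mul, h, Matrix.map_one _ (map_zero _) (map_one _)]

/-- **`P` is `U(n)`-invariant**: `ḡᵀ g = (gᴴ g)‾ = 1`. [folklore] -/
theorem isVCUnitaryInvariant_pairing : IsVCUnitaryInvariant (pairing ℂ n) := fun g => by
  classical
  rw [pairing_eq_pairingPoly]
  refine linSubst_pairingPoly_of_unitary _ _ _ ((g : Matrix (Fin n) (Fin n) ℂ).map (starRingEnd ℂ))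
    (map_conj_mem_unitaryGroup g) (fun a => ?_) (fun a => ?_)
  · rw [linSubst_vcBlock_X_inl]; rfl
  · rw [linSubst_vcBlock_X_inr]
    refine Finset.sum_congr rfl fun b _ => ?_
    rw [Matrix.map_apply, starRingEnd_apply, star_star]

/-- Powers of `P` are invariant. [folklore] -/
theorem isVCUnitaryInvariant_pairing_pow (k : ℕ) : IsVCUnitaryInvariant (pairing ℂ n ^ k) := fun g => by
  rw [map_pow, isVCUnitaryInvariant_pairing g]

/-- `ℂ[P]` consists of invariants. [folklore] -/
theorem isVCUnitaryInvariant_of_mem_span {F : MvPolynomial (VCVar n) ℂ}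
    (hF : F ∈ Submodule.span ℂ (Set.range fun k : ℕ => pairing ℂ n ^ k)) : IsVCUnitaryInvariant F := by
  change F ∈ vcUnitaryInvariants n
  refine (Submodule.span_le.mpr ?_) hF
  rintro _ ⟨k, rfl⟩
  exact isVCUnitaryInvariant_pairing_pow k

/-! ### Differentiating the invariance: `dΓ(diag(−Yᵀ, Y)) = Σ Y_{ab} E_{ab}` -/

/-- The infinitesimal generator of the block `diag(−Yᵀ, Y)` IS the polarisation representation:
`dΓ(diag(−Yᵀ, Y)) F = Σ_{a,b} Y_{ab} · E_{ab} F` for every `Y ∈ 𝔤𝔩_n(ℂ)`. [folklore] -/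
theorem dGamma_vcGen (Y : Matrix (Fin n) (Fin n) ℂ) (F : MvPolynomial (VCVar n) ℂ) :
    dGamma (Matrix.fromBlocks (-Yᵀ) 0 0 Y) F = ∑ a, ∑ b, Y a b • polarization a b F := by
  have hR : ∑ a, ∑ b, Y a b • polarization a b F =
      ∑ a, ∑ b, Y a b • (X (Sum.inl a) * pderiv (Sum.inl b) F) +
        -∑ a, ∑ b, Y a b • (X (Sum.inr b) * pderiv (Sum.inr a) F) := by
    simp only [polarization_apply, smul_sub, Finset.sum_sub_distrib]
    rw [sub_eq_add_neg]
  rw [hR, dGamma_apply, Fintype.sum_sum_type, neg_add]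
  congr 1
  · have h1 : ∀ a : Fin n, -∑ k : VCVar n, Matrix.fromBlocks (-Yᵀ) 0 0 Y (Sum.inl a) k • (X k * pderiv (Sum.inl a) F)
        = ∑ b, Y b a • (X (Sum.inl b) * pderiv (Sum.inl a) F) := by
      intro a
      rw [Fintype.sum_sum_type]
      simp only [Matrix.fromBlocks_apply₁₁, Matrix.fromBlocks_apply₁₂, Matrix.zero_apply, zero_smul,
        Finset.sum_const_zero, add_zero, Matrix.neg_apply, Matrix.transpose_apply, neg_smul,
        Finset.sum_neg_distrib, neg_neg]
    rw [← Finset.sum_neg_distrib, Finset.sum_congr rfl fun a _ => h1 a, Finset.sum_comm]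
  · have h2 : ∀ a : Fin n, ∑ k : VCVar n, Matrix.fromBlocks (-Yᵀ) 0 0 Y (Sum.inr a) k • (X k * pderiv (Sum.inr a) F)
        = ∑ b, Y a b • (X (Sum.inr b) * pderiv (Sum.inr a) F) := by
      intro a
      rw [Fintype.sum_sum_type]
      simp only [Matrix.fromBlocks_apply₂₁, Matrix.fromBlocks_apply₂₂, Matrix.zero_apply, zero_smul,
        Finset.sum_const_zero, zero_add]
    rw [Finset.sum_congr rfl fun a _ => h2 a]

/-- For a skew-hermitian `X`, the entrywise conjugate is `−Xᵀ`. [folklore] -/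
theorem map_conj_eq_neg_transpose {X : Matrix (Fin n) (Fin n) ℂ} (hX : star X = -X) :
    X.map (starRingEnd ℂ) = -Xᵀ := by
  have h : Xᴴ = -X := hX
  ext a b
  have hab := congrFun (congrFun h b) a
  rw [Matrix.conjTranspose_apply, Matrix.neg_apply] at hab
  rw [Matrix.map_apply, Matrix.neg_apply, Matrix.transpose_apply, starRingEnd_apply, hab]

/-- **Step (i): the derivative of the invariance along `e^{tX}`, `X ∈ 𝔲(n)`**:
`Σ_{a,b} X_{ab} E_{ab} F = 0`. [folklore] -/
theorem sum_polarization_eq_zero_of_skew {F : MvPolynomial (VCVar n) ℂ} (hF : IsVCUnitaryInvariant F)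
    {X : Matrix (Fin n) (Fin n) ℂ} (hX : star X = -X) :
    ∑ a, ∑ b, X a b • polarization a b F = 0 := by
  classical
  -- the matrix path `t ↦ vcBlock (e^{tX})` and its velocity `vcBlock X` (as a formula) at `t = 0`
  let P : ℝ → Matrix (VCVar n) (VCVar n) ℂ := fun t => vcBlock (expUnitary X hX t : Matrix (Fin n) (Fin n) ℂ)
  have hP : ∀ j k, HasDerivAt (fun t => P t j k) (vcBlock X j k) 0 := by
    rintro (a | a) (b | b)
    · simp only [P, vcBlock_inl_inl]
      exact (hasDerivAt_expUnitary_entry_zero hX a b).star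
    · simp only [P, vcBlock_inl_inr]; exact hasDerivAt_const _ _
    · simp only [P, vcBlock_inr_inl]; exact hasDerivAt_const _ _
    · simp only [P, vcBlock_inr_inr]; exact hasDerivAt_expUnitary_entry_zero hX a b
  have hP0 : P 0 = 1 := by simp only [P, expUnitary_zero]; exact vcBlock_one
  -- every coefficient of `F ∘ P(t) = F` is constant, so the derivative vanishes
  have hzero : dirDeriv (1 : Matrix (VCVar n) (VCVar n) ℂ) (vcBlock X) F = 0 := by
    refine MvPolynomial.ext _ _ fun m => ?_
    have hd := hasDerivAt_coeff_linSubst (P := P) hP F m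
    rw [hP0] at hd
    have hconst : (fun t => coeff m (linSubst (P t) F)) = fun _ => coeff m F := funext fun t => by
      simp only [P, hF (expUnitary X hX t)]
    rw [hconst] at hd
    rw [coeff_zero]
    exact hd.unique (hasDerivAt_const (0 : ℝ) (coeff m F))
  rw [dirDeriv_one, neg_eq_zero, vcBlock, map_conj_eq_neg_transpose hX, dGamma_vcGen] at hzero
  exact hzero

/-- **Step (ii): complexification** — every polarisation kills an invariant: `E_{ab} F = 0`. [folklore] -/
theorem polarization_eq_zero_of_isVCUnitaryInvariant {F : MvPolynomial (VCVar n) ℂ} (hF : IsVCUnitaryInvariant F)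
    (a b : Fin n) : polarization a b F = 0 := by
  -- the `ℂ`-linear functional `Y ↦ Σ Y_{ab} E_{ab} F`
  let Φ : Matrix (Fin n) (Fin n) ℂ → MvPolynomial (VCVar n) ℂ := fun Y => ∑ a, ∑ b, Y a b • polarization a b F
  have hΦadd : ∀ Y Z, Φ (Y + Z) = Φ Y + Φ Z := fun Y Z => by
    simp only [Φ, Matrix.add_apply, add_smul, Finset.sum_add_distrib]
  have hΦsmul : ∀ (c : ℂ) Y, Φ (c • Y) = c • Φ Y := fun c Y => by
    simp only [Φ, Matrix.smul_apply, smul_eq_mul, mul_smul, Finset.smul_sum]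
  have hΦsingle : Φ (Matrix.single a b 1) = polarization a b F := by
    change ∑ a', ∑ b', Matrix.single a b (1 : ℂ) a' b' • polarization a' b' F = polarization a b F
    rw [Finset.sum_eq_single a, Finset.sum_eq_single b, Matrix.single_apply_same, one_smul]
    · intro b' _ hb'; rw [Matrix.single_apply_of_col_ne _ _ (Ne.symm hb'), zero_smul]
    · exact fun h => absurd (Finset.mem_univ b) h
    · intro a' _ ha'
      exact Finset.sum_eq_zero fun b' _ => by rw [Matrix.single_apply_of_row_ne (Ne.symm ha'), zero_smul]
    · exact fun h => absurd (Finset.mem_univ a) h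
  -- `e_{ab} = X₁ + i X₂` with `X₁ = e_{ab} − e_{ba}`… precisely `2 e_{ab} = (e_{ab} − e_{ba}) − i · (i(e_{ab} + e_{ba}))`
  set E := (Matrix.single a b (1 : ℂ)) with hE
  have hEstar : star E = Matrix.single b a (1 : ℂ) := by
    rw [hE, Matrix.star_eq_conjTranspose, Matrix.conjTranspose_single, star_one]
  have hX₁ : star (E - star E) = -(E - star E) := by rw [star_sub, star_star, neg_sub]
  have hX₂ : star (I • (E + star E)) = -(I • (E + star E)) := by
    rw [star_smul, star_add, star_star, add_comm, Complex.star_def, Complex.conj_I, neg_smul]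
  have h1 := sum_polarization_eq_zero_of_skew hF hX₁
  have h2 := sum_polarization_eq_zero_of_skew hF hX₂
  change Φ (E - star E) = 0 at h1
  change Φ (I • (E + star E)) = 0 at h2
  have h2' : Φ (E + star E) = 0 := by
    rw [hΦsmul] at h2
    exact (smul_eq_zero.mp h2).resolve_left I_ne_zero
  have hsum : Φ (E - star E) + Φ (E + star E) = (2 : ℂ) • Φ E := by
    rw [← hΦadd, sub_add_add_cancel, ← two_smul ℂ, hΦsmul]
  rw [h1, h2', add_zero] at hsum
  have hE0 : Φ E = 0 := (smul_eq_zero.mp hsum.symm).resolve_left two_ne_zero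
  rwa [hE, hΦsingle] at hE0

/-- An invariant is `𝔤𝔩_n`-invariant in the sense of `VectorCovectorFFT`. [folklore] -/
theorem IsVCUnitaryInvariant.isGLnInvariant {F : MvPolynomial (VCVar n) ℂ} (hF : IsVCUnitaryInvariant F) :
    IsGLnInvariant F := fun a b => polarization_eq_zero_of_isVCUnitaryInvariant hF a b

/-! ### The theorem -/

variable [NeZero n]

/-- **FFT for `U(n)` on `V ⊕ V̄`, group form**: `F(ḡz, gw) = F(z,w)` for all `g ∈ U(n)` iff `F ∈ ℂ[P]`.
[cite: GoodmanWallachGTM255, Thm 5.2.1] -/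
theorem isVCUnitaryInvariant_iff (F : MvPolynomial (VCVar n) ℂ) :
    IsVCUnitaryInvariant F ↔ F ∈ Submodule.span ℂ (Set.range fun k : ℕ => pairing ℂ n ^ k) :=
  ⟨fun hF => (isGLnInvariant_iff F).mp hF.isGLnInvariant, isVCUnitaryInvariant_of_mem_span⟩

/-- The invariant submodule is `ℂ[P]`. [cite: GoodmanWallachGTM255, Thm 5.2.1] -/
theorem vcUnitaryInvariants_eq_span :
    vcUnitaryInvariants n = Submodule.span ℂ (Set.range fun k : ℕ => pairing ℂ n ^ k) :=
  Submodule.ext isVCUnitaryInvariant_iff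

/-- `U(n)`-invariance and `𝔤𝔩_n(ℂ)`-invariance coincide on `ℂ[V ⊕ V^*]` (Weyl's unitarian trick for this polynomial
representation). [cite: GoodmanWallachGTM255, Thm 5.2.1] -/
theorem isVCUnitaryInvariant_iff_isGLnInvariant (F : MvPolynomial (VCVar n) ℂ) :
    IsVCUnitaryInvariant F ↔ IsGLnInvariant F := by
  rw [isVCUnitaryInvariant_iff, isGLnInvariant_iff]

/-! ### Homogeneous invariants: `c · P^{d/2}` or `0` -/

omit [NeZero n] in
/-- `P` is homogeneous of degree `2`. [folklore] -/
theorem isHomogeneous_pairing : (pairing ℂ n).IsHomogeneous 2 := by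
  rw [pairing]
  refine IsHomogeneous.sum _ _ _ fun a _ => ?_
  exact (isHomogeneous_X ℂ (Sum.inl a)).mul (isHomogeneous_X ℂ (Sum.inr a))

omit [NeZero n] in
/-- `P^k` is homogeneous of degree `2k`. [folklore] -/
theorem isHomogeneous_pairing_pow (k : ℕ) : (pairing ℂ n ^ k).IsHomogeneous (2 * k) := by
  simpa [mul_comm] using isHomogeneous_pairing.pow k

/-- **A homogeneous `U(n)`-invariant of degree `d` is a multiple of `P^{d/2}` if `d` is even and `0` if `d` is odd.**
[cite: GoodmanWallachGTM255, Thm 5.2.1] -/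
theorem IsVCUnitaryInvariant.eq_smul_pairing_pow_of_isHomogeneous {F : MvPolynomial (VCVar n) ℂ}
    (hF : IsVCUnitaryInvariant F) {d : ℕ} (hd : F.IsHomogeneous d) :
    ∃ c : ℂ, F = c • pairing ℂ n ^ (d / 2) ∧ (¬ Even d → c = 0) := by
  classical
  obtain ⟨c, hc⟩ := (Finsupp.mem_span_range_iff_exists_finsupp).mp ((isVCUnitaryInvariant_iff F).mp hF)
  have hF' : F = ∑ k ∈ c.support, c k • pairing ℂ n ^ k := by rw [← hc]; rfl
  -- the degree-`d` homogeneous component of `F = Σ_k c_k P^k`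
  have key : F = ∑ k ∈ c.support, (if d = 2 * k then c k • pairing ℂ n ^ k else 0) := by
    conv_lhs => rw [← homogeneousComponent_eq_self hd, hF', map_sum]
    refine Finset.sum_congr rfl fun k _ => ?_
    rw [map_smul, homogeneousComponent_of_mem (isHomogeneous_pairing_pow k)]
    split_ifs <;> simp
  by_cases he : Even d
  · refine ⟨c (d / 2), ?_, fun h => absurd he h⟩
    obtain ⟨k₀, rfl⟩ := he
    have hk₀ : (k₀ + k₀) / 2 = k₀ := by omega
    rw [hk₀, key, Finset.sum_eq_single k₀]
    · rw [if_pos (two_mul k₀).symm]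
    · intro k _ hk
      rw [if_neg]
      omega
    · intro hk₀'
      rw [if_pos (two_mul k₀).symm, Finsupp.notMem_support_iff.mp hk₀', zero_smul]
  · refine ⟨0, ?_, fun _ => rfl⟩
    rw [zero_smul, key]
    refine Finset.sum_eq_zero fun k _ => ?_
    rw [if_neg]
    rintro rfl
    exact he ⟨k, two_mul k⟩

end Literature.RepresentationTheory.ClassicalInvariants

end
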